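import Literature.Geometry.Riemannian.SphereGeodesics
import Literature.Geometry.Riemannian.ConstantCurvatureJacobi
import Literature.Geometry.Riemannian.LocalIsometryRigidity
import Literature.Geometry.Riemannian.RiemannianDistance
import HarnessLib

/-!
# A complete Riemannian manifold of constant curvature `1` receives a local isometry from the
# round sphere (Cartan's theorem; the geometric step of the Killing–Hopf theorem)

Lee, *Introduction to Riemannian Manifolds*, 2nd ed. (2018), Thm. 12.4 (Killing–Hopf) is proved
there through Cor. 12.3 / Thm. 10.14 (local isometries of spaces of the same constant curvature)
and covering theory. do Carmo, *Riemannian Geometry* (1992), Ch. 8, Thm. 4.1 gives the direct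
argument for the sphere which we formalize: for `M` complete of constant curvature `1` and
`dim M = n`, fix `p ∈ Sⁿ`, `p̃ ∈ M` and a linear isometry `i : T_p Sⁿ → T_{p̃} M`; then
`f = exp_{p̃} ∘ i ∘ exp_p⁻¹ : Sⁿ ∖ {-p} → M` is a local isometry by Cartan's theorem (Ch. 8,
Thm. 2.1), a second such map built at `q ≠ ±p` from the 1-jet of `f` at `q` agrees with `f` on
the (connected) common domain, and the two glue to a local isometry `Sⁿ → M`.

Over the tree's `PseudoRiemannianMetric` / `expMap` and the proved inputs
`SphereGeodesics.lean` (the exponential map of the round sphere: injective on the ball of radius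
`π`, onto `Sⁿ ∖ {-p}`), `ConstantCurvatureJacobi.lean` (Cartan's lemma: `exp^* g` on `T_p` is an
explicit function of `g_p` in constant curvature `1`, on `M` AND on `Sⁿ`) and
`LocalIsometryRigidity.lean` (O'Neill's Prop. 3.62 for maps isometric on a preconnected open
set), everything PROVED (namespace `SphereLocalIsometry`):

* `sphereExp`, `targetExp` — `exp^{Sⁿ}_p` and `exp^M_{p̃} ∘ ι` on the model tangent space;
  `val_mfderiv_targetExp_eq` — **Cartan's comparison** `g(d(e₂) w, d(e₂) w') = g_round(d(e₁) w, d(e₁) w')`;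
* `ballPi`, `sphereLog` — the ball of radius `π` in `(T_p Sⁿ, g_round)` and the inverse of `exp_p`
  on it (smooth off the antipode: it is the local inverse given by the inverse function theorem,
  `sphereLog_eventuallyEq_localInverse`);
* `puncturedMap p g p̃ ι` — Cartan's map; `C^∞` and isometric off `-p`
  (`val_mfderiv_puncturedMap`), with `f p = p̃` and `df_p = ι` (`mfderiv_puncturedMap_self`);
* `isPreconnected_ne_ne` — `Sⁿ` minus two points is preconnected for `n ≥ 2` (stereographic
  projection and `isConnected_compl_singleton_of_one_lt_rank`);
* `exists_linearIsometry_tangent` — a linear isometry `(T_p Sⁿ, g_round) → (T_{p̃} M, g)` exists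
  (`OrthonormalBasis.equiv` for the inner products `riemannianBundle`);
* `exists_isLocalIsometry` — **the theorem**: for `n ≥ 2`, `g` positive definite `C^∞` with
  complete Levi-Civita connection of constant curvature `1` and `dim M = n`, there is a `C^∞` map
  `F : Sⁿ → M` with `F p = p̃` and `g(dF X, dF Y) = g_round(X, Y)` everywhere.

No definitions of `Prop` type, no named facts (D-0026). Consumed by `KillingHopfPositive.lean`
(hypothesis (H2) of `HamiltonPCOClassificationProofs.lean`).

## References

* J. M. Lee, *Introduction to Riemannian Manifolds*, 2nd ed., GTM 176, Springer (2018):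
  Prop. 5.19, Prop. 10.10, Prop. 10.12, Thm. 10.14, Cor. 12.3, Thm. 12.4. [Lee2018]
* M. P. do Carmo, *Riemannian Geometry*, Birkhäuser (1992), Ch. 8, Thm. 2.1 (Cartan) and
  Thm. 4.1 with its proof. [doCarmo1992]
* B. O'Neill, *Semi-Riemannian geometry* (1983), Ch. 3, Prop. 3.62. [ONeill1983]
-/

noncomputable section

open Bundle Set Function Filter Metric Module
open scoped Manifold ContDiff Topology RealInnerProductSpace

namespace Literature.Geometry.Riemannian

open Lorentzian Lorentzian.PseudoRiemannianMetric

namespace SphereLocalIsometry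

variable {V : Type*} [NormedAddCommGroup V] [InnerProductSpace ℝ V] {n : ℕ}
  [Fact (finrank ℝ V = n + 1)] [(roundMetric (n := n) V).HasLeviCivita]
  {E : Type*} [NormedAddCommGroup E] [NormedSpace ℝ E] {H : Type*} [TopologicalSpace H]
  {I : ModelWithCorners ℝ E H} [I.Boundaryless] {M : Type*} [TopologicalSpace M]
  [ChartedSpace H M] [IsManifold I ∞ M] [FiniteDimensional ℝ E] [CompleteSpace E] [T2Space M]
  {g : PseudoRiemannianMetric I ∞ E (TangentSpace I : M → Type _)} [g.HasLeviCivita]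

/-- `dι[y]`: the differential at `y` of the inclusion `ι : Sⁿ ↪ V`, as a map into `V`. -/
local notation "dι[" y "]" => mvfderiv (𝓡 n) (Subtype.val : sphere (0 : V) 1 → V) y

/-- Local notation for the model space `ℝⁿ` of the sphere charts (and tangent spaces). -/
local notation "ES" => EuclideanSpace ℝ (Fin n)

attribute [local instance] contMDiffCovariantDerivative_roundMetric_one
  contMDiffCovariantDerivative_roundMetric_top

/-! ### The two exponential maps read on `T_p Sⁿ` -/

variable (V n) in
/-- `e₁ p u = exp^{Sⁿ}_p(u)`: the exponential map of the round sphere at `p`, on the model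
tangent space. [folklore] -/
def sphereExp (p : sphere (0 : V) 1) (u : ES) : sphere (0 : V) 1 :=
  expMap (roundMetric (n := n) V).leviCivita p (show TangentSpace (𝓡 n) p from u)

/-- `e₂ pt ι u = exp^{M}_{pt}(ι u)`: the exponential map of `M` at `pt` precomposed with a linear
map `ι : T_p Sⁿ → T_{pt} M`. [folklore] -/
def targetExp (g : PseudoRiemannianMetric I ∞ E (TangentSpace I : M → Type _)) [g.HasLeviCivita]
    (pt : M) (ι : ES →L[ℝ] E) (u : ES) : M :=
  expMap g.leviCivita pt (show TangentSpace I pt from ι u)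

/-- The round sphere has constant curvature `1` for its Levi-Civita connection (from the tree's
`curvature_roundMetric`; cf. `hasConstantSectionalCurvatureWith_roundMetric`). [cite: Lee2018, Thm. 8.34 (b)] -/
theorem hasConstantSectionalCurvatureWith_roundMetric_leviCivita :
    (roundMetric (n := n) V).HasConstantSectionalCurvatureWith
      (roundMetric (n := n) V).leviCivita 1 := by
  intro x X Y Z W
  rw [curvatureForm, curvature_roundMetric (isLeviCivita_leviCivita_holds (g := roundMetric V))
    x X Y Z, map_sub, map_smul, map_smul]
  simp only [_root_.sub_apply, _root_.smul_apply, smul_eq_mul]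
  ring

/-- The Levi-Civita connection of the round metric is locally `C¹`. [folklore] -/
theorem isLocallyContMDiff_roundMetric_one :
    (roundMetric (n := n) V).leviCivita.IsLocallyContMDiff 1 :=
  (roundMetric (n := n) V).isLocallyContMDiff_leviCivita_holds 1
    (by rw [show ((1 : ℕ∞) : ℕ∞ω) + 1 = 2 by norm_num]; exact WithTop.coe_le_coe.2 le_top)

omit [(roundMetric (n := n) V).HasLeviCivita] [I.Boundaryless] [FiniteDimensional ℝ E]
  [CompleteSpace E] [T2Space M] [g.HasLeviCivita] [Fact (finrank ℝ V = n + 1)] in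
/-- A linear map which is isometric for `(g_round)_p` and `g_{pt}` is injective when `g_round` is
positive definite. [folklore] -/
theorem injective_of_isometric [Fact (finrank ℝ V = n + 1)] {p : sphere (0 : V) 1} {pt : M}
    {ι : ES →L[ℝ] E}
    (hι : ∀ u w : ES, g.val pt (show TangentSpace I pt from ι u) (show TangentSpace I pt from ι w) =
      (roundMetric (n := n) V).val p u w) : Injective ι := by
  rw [injective_iff_map_eq_zero]
  intro u hu
  have h := hι u u
  have h' : g.val pt (show TangentSpace I pt from ι u) (show TangentSpace I pt from ι u) = 0 := by
    have h0 : (show TangentSpace I pt from ι u) = 0 := hu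
    rw [h0, map_zero]
  rw [h'] at h
  exact CartanHadamard.eq_zero_of_val_self_eq_zero isRiemannian_roundMetric p h.symm

/-- `sphereExp` is `C^∞`. [folklore] -/
theorem contMDiff_sphereExp (p : sphere (0 : V) 1) :
    ContMDiff 𝓘(ℝ, ES) (𝓡 n) ∞ (sphereExp V n p) := by
  have hc : IsGeodesicallyComplete (roundMetric (n := n) V).leviCivita :=
    isGeodesicallyComplete_roundMetric (n := n) (V := V)
  exact contMDiff_expMap_infty (I := 𝓡 n) hc p

/-- `targetExp` is `C^∞` for a complete `g`. [folklore] -/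
theorem contMDiff_targetExp [CovariantDerivative.ContMDiffCovariantDerivative g.leviCivita 1]
    [CovariantDerivative.ContMDiffCovariantDerivative g.leviCivita ∞]
    (hc : IsGeodesicallyComplete g.leviCivita) (pt : M) (ι : ES →L[ℝ] E) :
    ContMDiff 𝓘(ℝ, ES) I ∞ (targetExp g pt ι) :=
  (contMDiff_expMap_infty (I := I) hc pt).comp ι.contDiff.contMDiff

/-- Chain rule for `targetExp = exp_{pt} ∘ ι`. [folklore] -/
theorem mfderiv_targetExp [CovariantDerivative.ContMDiffCovariantDerivative g.leviCivita 1]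
    [CovariantDerivative.ContMDiffCovariantDerivative g.leviCivita ∞]
    (hc : IsGeodesicallyComplete g.leviCivita) (pt : M) (ι : ES →L[ℝ] E) (v w : ES) :
    mfderiv 𝓘(ℝ, ES) I (targetExp g pt ι) v w =
      mfderiv 𝓘(ℝ, E) I (fun x : E ↦ expMap g.leviCivita pt (show TangentSpace I pt from x))
        (ι v) (ι w) := by
  have h1 : MDifferentiableAt 𝓘(ℝ, E) I
      (fun x : E ↦ expMap g.leviCivita pt (show TangentSpace I pt from x)) (ι v) :=
    ((contMDiff_expMap_infty (I := I) hc pt) _).mdifferentiableAt (by simp)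
  have h2 : MDifferentiableAt 𝓘(ℝ, ES) 𝓘(ℝ, E) (⇑ι) v := ι.contDiff.contMDiff.mdifferentiableAt
    (n := 1) one_ne_zero
  have h := mfderiv_comp v h1 h2
  rw [ContinuousLinearMap.mfderiv_eq] at h
  exact congrArg (fun f ↦ f w) h

/-- **Cartan's comparison**: with `ι` isometric, the pullbacks of `g_round` under `e₁ = exp^{Sⁿ}_p`
and of `g` under `e₂ = exp^{M}_{pt} ∘ ι` agree on `T_p Sⁿ`:
`g(d(e₂)_v w, d(e₂)_v w') = g_round(d(e₁)_v w, d(e₁)_v w')`, both being given by the same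
expression in `(g_round)_p` (`val_mfderiv_expMap_of_curvature_one` on `Sⁿ` and on `M`, both of
constant curvature `1`). Lee 2018, Thm. 10.14 (proof) / do Carmo Ch. 8, Thm. 2.1.
[cite: Lee2018, Prop. 10.12] -/
theorem val_mfderiv_targetExp_eq [CovariantDerivative.ContMDiffCovariantDerivative g.leviCivita 1]
    [CovariantDerivative.ContMDiffCovariantDerivative g.leviCivita ∞]
    (hg : g.IsRiemannian) (hK : g.HasConstantSectionalCurvatureWith g.leviCivita 1)
    (hcov₁ : g.leviCivita.IsLocallyContMDiff 1) (hc : IsGeodesicallyComplete g.leviCivita)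
    (p : sphere (0 : V) 1) (pt : M) (ι : ES →L[ℝ] E)
    (hι : ∀ u w : ES, g.val pt (show TangentSpace I pt from ι u) (show TangentSpace I pt from ι w) =
      (roundMetric (n := n) V).val p u w) (v w w' : ES) :
    g.val (targetExp g pt ι v) (mfderiv 𝓘(ℝ, ES) I (targetExp g pt ι) v w)
        (mfderiv 𝓘(ℝ, ES) I (targetExp g pt ι) v w') =
      (roundMetric (n := n) V).val (sphereExp V n p v) (mfderiv 𝓘(ℝ, ES) (𝓡 n) (sphereExp V n p) v w)
        (mfderiv 𝓘(ℝ, ES) (𝓡 n) (sphereExp V n p) v w') := by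
  set gS := roundMetric (n := n) V with hgS
  have hcS : IsGeodesicallyComplete gS.leviCivita :=
    isGeodesicallyComplete_roundMetric (n := n) (V := V)
  have hKS := hasConstantSectionalCurvatureWith_roundMetric_leviCivita (n := n) (V := V)
  have hcovS := isLocallyContMDiff_roundMetric_one (n := n) (V := V)
  have hgS' : gS.IsRiemannian := isRiemannian_roundMetric
  -- the target side read through `exp_{pt}`
  have hT : ∀ a : ES, mfderiv 𝓘(ℝ, ES) I (targetExp g pt ι) v a =
      mfderiv 𝓘(ℝ, E) I (fun x : E ↦ expMap g.leviCivita pt (show TangentSpace I pt from x))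
        (ι v) (ι a) := fun a ↦ mfderiv_targetExp hc pt ι v a
  have hpt : targetExp g pt ι v = expMap g.leviCivita pt (show TangentSpace I pt from ι v) := rfl
  have hp : sphereExp V n p = fun u : ES ↦ expMap gS.leviCivita p (show TangentSpace (𝓡 n) p from u) :=
    rfl
  rw [hp]
  by_cases hv : v = 0
  · -- at the origin both differentials are the identity
    subst hv
    have key : ∀ (x : E) (hx : x = 0) (a b : E),
        g.val (expMap g.leviCivita pt (show TangentSpace I pt from x))
          (mfderiv 𝓘(ℝ, E) I (fun x : E ↦ expMap g.leviCivita pt (show TangentSpace I pt from x))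
            x a)
          (mfderiv 𝓘(ℝ, E) I (fun x : E ↦ expMap g.leviCivita pt (show TangentSpace I pt from x))
            x b) = g.val pt (show TangentSpace I pt from a) (show TangentSpace I pt from b) := by
      intro x hx a b; subst hx
      exact val_mfderiv_expMap_zero (I := I) hc pt a b
    rw [hT, hT, hpt, key (ι 0) (map_zero ι), hι]
    exact (val_mfderiv_expMap_zero (I := 𝓡 n) hcS p w w').symm
  · have hιv : ι v ≠ 0 := fun h ↦ hv (injective_of_isometric hι (by rw [h, map_zero]))
    rw [hT, hT, hpt, val_mfderiv_expMap_of_curvature_one (I := I) hg hK hcov₁ hc pt hιv,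
      val_mfderiv_expMap_of_curvature_one (I := 𝓡 n) hgS' hKS hcovS hcS p hv]
    simp only [hι]


/-! ### The ball of radius `π` in `T_p Sⁿ` and the inverse of `exp_p` on it -/

omit [(roundMetric (n := n) V).HasLeviCivita] in
/-- `g_round(u, u) = ‖dι u‖²`. [folklore] -/
theorem val_self_eq_norm_sq (p : sphere (0 : V) 1) (u : ES) :
    (roundMetric (n := n) V).val p u u = ‖dι[p] u‖ ^ 2 := by
  rw [roundMetric_val_eq_inner, real_inner_self_eq_norm_sq]

variable (V n) in
/-- The open ball of radius `π` of `(T_p Sⁿ, (g_round)_p)`, read in the model space. [folklore] -/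
def ballPi (p : sphere (0 : V) 1) : Set ES := {u | ‖dι[p] u‖ < Real.pi}

omit [(roundMetric (n := n) V).HasLeviCivita] in
/-- Membership in `ballPi`. [folklore] -/
theorem mem_ballPi {p : sphere (0 : V) 1} {u : ES} : u ∈ ballPi V n p ↔ ‖dι[p] u‖ < Real.pi :=
  Iff.rfl

omit [(roundMetric (n := n) V).HasLeviCivita] in
/-- `ballPi` is open. [folklore] -/
theorem isOpen_ballPi (p : sphere (0 : V) 1) : IsOpen (ballPi V n p) :=
  isOpen_lt ((dι[p]).continuous.norm) continuous_const

omit [(roundMetric (n := n) V).HasLeviCivita] in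
/-- `0 ∈ ballPi`. [folklore] -/
theorem zero_mem_ballPi (p : sphere (0 : V) 1) : (0 : ES) ∈ ballPi V n p := by
  show ‖dι[p] (0 : TangentSpace (𝓡 n) p)‖ < Real.pi
  rw [map_zero, norm_zero]; exact Real.pi_pos

omit [(roundMetric (n := n) V).HasLeviCivita] in
/-- On `ballPi`, `g_round(u, u) < π²`. [folklore] -/
theorem val_self_lt_of_mem_ballPi {p : sphere (0 : V) 1} {u : ES} (hu : u ∈ ballPi V n p) :
    (roundMetric (n := n) V).val p u u < Real.pi ^ 2 := by
  rw [val_self_eq_norm_sq]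
  exact pow_lt_pow_left₀ hu (norm_nonneg _) two_ne_zero

/-- `exp_p` is injective on `ballPi` (`expMap_roundMetric_injOn`). [cite: Lee2018, Prop. 5.27] -/
theorem sphereExp_injOn (p : sphere (0 : V) 1) : InjOn (sphereExp V n p) (ballPi V n p) :=
  fun _ hu _ hw h ↦ expMap_roundMetric_injOn p hu hw h

/-- `exp_p` does not reach the antipode on `ballPi`. [cite: Lee2018, Prop. 5.27] -/
theorem coe_sphereExp_ne_neg {p : sphere (0 : V) 1} {u : ES} (hu : u ∈ ballPi V n p) :
    ((sphereExp V n p u : sphere (0 : V) 1) : V) ≠ -(p : V) :=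
  coe_expMap_roundMetric_ne_neg p hu

/-- Every point other than the antipode is reached from `ballPi`. [cite: Lee2018, Prop. 5.27] -/
theorem exists_sphereExp_eq (p : sphere (0 : V) 1) {x : sphere (0 : V) 1} (hx : (x : V) ≠ -(p : V)) :
    ∃ u ∈ ballPi V n p, sphereExp V n p u = x := by
  obtain ⟨u, hu, hux⟩ := exists_expMap_roundMetric_eq (n := n) p hx
  exact ⟨u, hu, hux⟩

/-- `exp_p 0 = p`. [folklore] -/
theorem sphereExp_zero (p : sphere (0 : V) 1) : sphereExp V n p 0 = p :=
  expMap_zero (cov := (roundMetric (n := n) V).leviCivita) p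

/-- On `ballPi` the differential of `exp_p` is injective (no conjugate point before `π`;
`mfderiv_expMap_injective_of_curvature_one` for the round sphere). [cite: Lee2018, Prop. 10.12] -/
theorem mfderiv_sphereExp_injective {p : sphere (0 : V) 1} {u : ES} (hu : u ∈ ballPi V n p) :
    Injective (mfderiv 𝓘(ℝ, ES) (𝓡 n) (sphereExp V n p) u) := by
  have hc : IsGeodesicallyComplete (roundMetric (n := n) V).leviCivita :=
    isGeodesicallyComplete_roundMetric (n := n) (V := V)
  exact mfderiv_expMap_injective_of_curvature_one (I := 𝓡 n) isRiemannian_roundMetric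
    hasConstantSectionalCurvatureWith_roundMetric_leviCivita isLocallyContMDiff_roundMetric_one hc
    p (val_self_lt_of_mem_ballPi hu)

/-- On `ballPi`, `exp_p` is a local diffeomorphism (inverse function theorem). [folklore] -/
theorem isLocalDiffeomorphAt_sphereExp {p : sphere (0 : V) 1} {u : ES} (hu : u ∈ ballPi V n p) :
    IsLocalDiffeomorphAt 𝓘(ℝ, ES) (𝓡 n) ∞ (sphereExp V n p) u := by
  have hinj := mfderiv_sphereExp_injective hu
  set L : ES ≃ₗ[ℝ] ES := (mfderivEquivOfInjective (I := 𝓡 n) (I' := 𝓘(ℝ, ES))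
    (sphereExp V n p) u hinj rfl) with hL
  refine Literature.Topology.FourManifolds.isLocalDiffeomorphAt_of_mfderiv isOpen_univ (mem_univ u)
    (contMDiff_sphereExp p).contMDiffOn (by exact_mod_cast le_top) L.toContinuousLinearEquiv ?_
  ext v
  rfl

variable (V n) in
open Classical in
/-- **The inverse of `exp_p` on the ball of radius `π`**: `sphereLog p x` is the unique
`u ∈ ballPi p` with `exp_p u = x` for `x ≠ -p` (and `0` at the antipode). [folklore] -/
def sphereLog (p : sphere (0 : V) 1) (x : sphere (0 : V) 1) : ES :=
  if h : (x : V) = -(p : V) then 0 else Classical.choose (exists_sphereExp_eq p h)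

/-- `sphereLog p x ∈ ballPi p`. [folklore] -/
theorem sphereLog_mem (p x : sphere (0 : V) 1) : sphereLog V n p x ∈ ballPi V n p := by
  unfold sphereLog
  split_ifs with h
  · exact zero_mem_ballPi p
  · exact (Classical.choose_spec (exists_sphereExp_eq p h)).1

/-- `exp_p (sphereLog p x) = x` for `x ≠ -p`. [folklore] -/
theorem sphereExp_sphereLog {p x : sphere (0 : V) 1} (hx : (x : V) ≠ -(p : V)) :
    sphereExp V n p (sphereLog V n p x) = x := by
  unfold sphereLog
  rw [dif_neg hx]
  exact (Classical.choose_spec (exists_sphereExp_eq p hx)).2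

/-- `sphereLog p (exp_p u) = u` for `u ∈ ballPi p`. [folklore] -/
theorem sphereLog_sphereExp {p : sphere (0 : V) 1} {u : ES} (hu : u ∈ ballPi V n p) :
    sphereLog V n p (sphereExp V n p u) = u :=
  sphereExp_injOn p (sphereLog_mem p _) hu (sphereExp_sphereLog (coe_sphereExp_ne_neg hu))

/-- `sphereLog p p = 0`. [folklore] -/
theorem sphereLog_self (p : sphere (0 : V) 1) : sphereLog V n p p = 0 := by
  have h := sphereLog_sphereExp (zero_mem_ballPi (V := V) (n := n) p)
  rwa [sphereExp_zero] at h

/-- **Near a point other than the antipode, `sphereLog p` is the local inverse of `exp_p`**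
(hence smooth there). [folklore] -/
theorem sphereLog_eventuallyEq_localInverse {p x₀ : sphere (0 : V) 1} (hx₀ : (x₀ : V) ≠ -(p : V))
    (hloc : IsLocalDiffeomorphAt 𝓘(ℝ, ES) (𝓡 n) ∞ (sphereExp V n p) (sphereLog V n p x₀)) :
    sphereLog V n p =ᶠ[𝓝 x₀] hloc.localInverse := by
  set u₀ := sphereLog V n p x₀ with hu₀
  set L := hloc.localInverse with hLdef
  have hx : sphereExp V n p u₀ = x₀ := sphereExp_sphereLog hx₀
  have hsrc : L.source ∈ 𝓝 x₀ := by
    rw [← hx]; exact L.open_source.mem_nhds hloc.localInverse_mem_source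
  have hLc : ContinuousAt L x₀ := by
    rw [← hx]; exact hloc.localInverse_contMDiffAt.continuousAt
  have hLx : L x₀ = u₀ := by
    rw [← hx]; exact hloc.localInverse_left_inv hloc.localInverse_mem_target
  have hball : ∀ᶠ x in 𝓝 x₀, L x ∈ ballPi V n p := by
    refine hLc.eventually_mem ?_
    rw [hLx]; exact (isOpen_ballPi p).mem_nhds (sphereLog_mem p x₀)
  filter_upwards [hsrc, hball] with x hxs hxb
  have h1 : sphereExp V n p (L x) = x := hloc.localInverse_right_inv hxs
  have h2 : (x : V) ≠ -(p : V) := by rw [← h1]; exact coe_sphereExp_ne_neg hxb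
  exact sphereExp_injOn p (sphereLog_mem p x) hxb ((sphereExp_sphereLog h2).trans h1.symm)

/-- `sphereLog p` is `C^∞` at every `x ≠ -p`. [folklore] -/
theorem contMDiffAt_sphereLog {p x : sphere (0 : V) 1} (hx : (x : V) ≠ -(p : V)) :
    ContMDiffAt (𝓡 n) 𝓘(ℝ, ES) ∞ (sphereLog V n p) x := by
  have hloc := isLocalDiffeomorphAt_sphereExp (sphereLog_mem (V := V) (n := n) p x)
  have h := hloc.localInverse_contMDiffAt
  rw [sphereExp_sphereLog hx] at h
  exact h.congr_of_eventuallyEq (sphereLog_eventuallyEq_localInverse hx hloc)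

/-- `d(exp_p)_{sphereLog x} ∘ d(sphereLog p)_x = id` for `x ≠ -p` (chain rule on
`exp_p ∘ sphereLog p = id` near `x`). [folklore] -/
theorem mfderiv_sphereExp_mfderiv_sphereLog {p x : sphere (0 : V) 1} (hx : (x : V) ≠ -(p : V))
    (X : TangentSpace (𝓡 n) x) :
    (mfderiv 𝓘(ℝ, ES) (𝓡 n) (sphereExp V n p) (sphereLog V n p x)
      (mfderiv (𝓡 n) 𝓘(ℝ, ES) (sphereLog V n p) x X) : ES) = X := by
  have h1 : MDifferentiableAt 𝓘(ℝ, ES) (𝓡 n) (sphereExp V n p) (sphereLog V n p x) :=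
    ((contMDiff_sphereExp p) _).mdifferentiableAt (by simp)
  have h2 : MDifferentiableAt (𝓡 n) 𝓘(ℝ, ES) (sphereLog V n p) x :=
    (contMDiffAt_sphereLog hx).mdifferentiableAt (by simp)
  have hcomp := mfderiv_comp x h1 h2
  -- `exp_p ∘ sphereLog p = id` near `x`
  have hopen : IsOpen {y : sphere (0 : V) 1 | (y : V) ≠ -(p : V)} :=
    isOpen_ne_fun continuous_subtype_val continuous_const
  have hev : sphereExp V n p ∘ sphereLog V n p =ᶠ[𝓝 x] id := by
    filter_upwards [hopen.mem_nhds hx] with y hy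
    exact sphereExp_sphereLog hy
  rw [hev.mfderiv_eq, mfderiv_id] at hcomp
  have key : ∀ (y : sphere (0 : V) 1) (hy : y = x) (A : TangentSpace (𝓡 n) x →L[ℝ] TangentSpace (𝓡 n) y)
      (hA : (ContinuousLinearMap.id ℝ (TangentSpace (𝓡 n) x) : ES →L[ℝ] ES) = A) (Y : ES),
      (A Y : ES) = Y := by
    intro y hy A hA Y; subst hy; rw [← hA]; rfl
  exact key _ (sphereExp_sphereLog hx) _ hcomp X


/-! ### The local isometry on the punctured sphere `Sⁿ ∖ {-p}` -/

/-- **Cartan's map** `f = exp^M_{pt} ∘ ι ∘ (exp^{Sⁿ}_p|_{B_π})⁻¹ : Sⁿ → M` (junk at `-p`).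
do Carmo, *Riemannian Geometry*, Ch. 8, proof of Thm. 4.1; Lee 2018, proof of Thm. 12.4 via
Cor. 12.3 / Thm. 10.14. [cite: Lee2018, Thm. 12.4 (proof)] -/
def puncturedMap (p : sphere (0 : V) 1) (g : PseudoRiemannianMetric I ∞ E (TangentSpace I : M → Type _))
    [g.HasLeviCivita] (pt : M) (ι : ES →L[ℝ] E) (x : sphere (0 : V) 1) : M :=
  targetExp g pt ι (sphereLog V n p x)

section Punctured

variable [CovariantDerivative.ContMDiffCovariantDerivative g.leviCivita 1]
  [CovariantDerivative.ContMDiffCovariantDerivative g.leviCivita ∞]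

omit [CovariantDerivative.ContMDiffCovariantDerivative g.leviCivita ∞] in
/-- `f p = pt`. [folklore] -/
theorem puncturedMap_self (p : sphere (0 : V) 1) (pt : M) (ι : ES →L[ℝ] E) :
    puncturedMap p g pt ι p = pt := by
  unfold puncturedMap targetExp
  rw [sphereLog_self, map_ι_zero ι]
  exact expMap_zero (cov := g.leviCivita) pt
where
  /-- `ι 0 = 0` read in `T_{pt} M`. [folklore] -/
  map_ι_zero (ι : ES →L[ℝ] E) : (show TangentSpace I pt from ι 0) = 0 := map_zero ι

/-- `f` is `C^∞` at every `x ≠ -p`. [folklore] -/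
theorem contMDiffAt_puncturedMap (hc : IsGeodesicallyComplete g.leviCivita) (p : sphere (0 : V) 1)
    (pt : M) (ι : ES →L[ℝ] E) {x : sphere (0 : V) 1} (hx : (x : V) ≠ -(p : V)) :
    ContMDiffAt (𝓡 n) I ∞ (puncturedMap p g pt ι) x :=
  ((contMDiff_targetExp hc pt ι) _).comp x (contMDiffAt_sphereLog hx)

/-- Chain rule for `f = targetExp ∘ sphereLog`. [folklore] -/
theorem mfderiv_puncturedMap (hc : IsGeodesicallyComplete g.leviCivita) (p : sphere (0 : V) 1)
    (pt : M) (ι : ES →L[ℝ] E) {x : sphere (0 : V) 1} (hx : (x : V) ≠ -(p : V))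
    (X : TangentSpace (𝓡 n) x) :
    mfderiv (𝓡 n) I (puncturedMap p g pt ι) x X =
      mfderiv 𝓘(ℝ, ES) I (targetExp g pt ι) (sphereLog V n p x)
        (mfderiv (𝓡 n) 𝓘(ℝ, ES) (sphereLog V n p) x X) := by
  have h1 : MDifferentiableAt 𝓘(ℝ, ES) I (targetExp g pt ι) (sphereLog V n p x) :=
    ((contMDiff_targetExp hc pt ι) _).mdifferentiableAt (by simp)
  have h2 : MDifferentiableAt (𝓡 n) 𝓘(ℝ, ES) (sphereLog V n p) x :=
    (contMDiffAt_sphereLog hx).mdifferentiableAt (by simp)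
  have h := mfderiv_comp x h1 h2
  exact congrArg (fun f ↦ f X) h

/-- **`f` is isometric at every `x ≠ -p`**: `g(df X, df Y) = g_round(X, Y)` — Cartan's
comparison `val_mfderiv_targetExp_eq` at `u = sphereLog p x` applied to `dσ X`, `dσ Y`, and
`d(exp_p)_u (dσ X) = X`. [cite: Lee2018, Thm. 10.14] -/
theorem val_mfderiv_puncturedMap (hg : g.IsRiemannian)
    (hK : g.HasConstantSectionalCurvatureWith g.leviCivita 1)
    (hcov₁ : g.leviCivita.IsLocallyContMDiff 1) (hc : IsGeodesicallyComplete g.leviCivita)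
    (p : sphere (0 : V) 1) (pt : M) (ι : ES →L[ℝ] E)
    (hι : ∀ u w : ES, g.val pt (show TangentSpace I pt from ι u) (show TangentSpace I pt from ι w) =
      (roundMetric (n := n) V).val p u w)
    {x : sphere (0 : V) 1} (hx : (x : V) ≠ -(p : V)) (X Y : TangentSpace (𝓡 n) x) :
    g.val (puncturedMap p g pt ι x) (mfderiv (𝓡 n) I (puncturedMap p g pt ι) x X)
      (mfderiv (𝓡 n) I (puncturedMap p g pt ι) x Y) = (roundMetric (n := n) V).val x X Y := by
  rw [mfderiv_puncturedMap hc p pt ι hx, mfderiv_puncturedMap hc p pt ι hx]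
  show g.val (targetExp g pt ι (sphereLog V n p x)) _ _ = _
  rw [val_mfderiv_targetExp_eq hg hK hcov₁ hc p pt ι hι]
  -- `exp_p (sphereLog p x) = x` and `d(exp_p) (dσ X) = X`
  have key : ∀ (y : sphere (0 : V) 1) (hy : y = x) (A B : ES)
      (hA : A = X) (hB : B = Y),
      (roundMetric (n := n) V).val y (show TangentSpace (𝓡 n) y from A)
        (show TangentSpace (𝓡 n) y from B) = (roundMetric (n := n) V).val x X Y := by
    intro y hy A B hA hB; subst hy; subst hA; subst hB; rfl
  exact key _ (sphereExp_sphereLog hx) _ _ (mfderiv_sphereExp_mfderiv_sphereLog hx X)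
    (mfderiv_sphereExp_mfderiv_sphereLog hx Y)

/-- **The differential of `f` at `p` is `ι`**: `df_p = d(exp_{pt})_0 ∘ ι ∘ d(sphereLog p)_p` with
`d(exp)_0 = id` on both sides. [folklore] -/
theorem mfderiv_puncturedMap_self (hc : IsGeodesicallyComplete g.leviCivita) (p : sphere (0 : V) 1)
    (pt : M) (ι : ES →L[ℝ] E) (hp : ((p : sphere (0 : V) 1) : V) ≠ -(p : V)) (X : TangentSpace (𝓡 n) p) :
    (mfderiv (𝓡 n) I (puncturedMap p g pt ι) p X : E) = ι X := by
  rw [mfderiv_puncturedMap hc p pt ι hp, mfderiv_targetExp hc pt ι]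
  -- `d(sphereLog p)_p X = X`: from `d(exp_p)_0 ∘ d(sphereLog)_p = id` and `d(exp_p)_0 = id`
  have hcS : IsGeodesicallyComplete (roundMetric (n := n) V).leviCivita :=
    isGeodesicallyComplete_roundMetric (n := n) (V := V)
  have h1 := mfderiv_sphereExp_mfderiv_sphereLog (V := V) (n := n) hp X
  rw [sphereLog_self] at h1 ⊢
  have h0S : mfderiv 𝓘(ℝ, ES) (𝓡 n) (sphereExp V n p) 0 = ContinuousLinearMap.id ℝ _ :=
    (hasMFDerivAt_expMap_zero (I := 𝓡 n) hcS p).mfderiv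
  rw [h0S] at h1
  have h1' : (mfderiv (𝓡 n) 𝓘(ℝ, ES) (sphereLog V n p) p X : ES) = X := h1
  -- `d(exp_{pt})_{ι 0}(ι X) = ι X`
  have key : ∀ (z : E) (hz : z = 0) (a : ES) (ha : a = X),
      (mfderiv 𝓘(ℝ, E) I (fun x : E ↦ expMap g.leviCivita pt (show TangentSpace I pt from x)) z
        (ι a) : E) = ι X := by
    intro z hz a ha; subst hz; subst ha
    rw [(hasMFDerivAt_expMap_zero (I := I) hc pt).mfderiv]; rfl
  exact key (ι 0) (map_zero ι) _ h1'

end Punctured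


/-! ### Topology of the sphere: the complement of two points is preconnected for `n ≥ 2` -/

omit [(roundMetric (n := n) V).HasLeviCivita] in
/-- **`Sⁿ` minus two points is preconnected for `n ≥ 2`**: stereographic projection from `a`
identifies `Sⁿ ∖ {a}` with `ℝⁿ`, and `ℝⁿ` minus a point is connected for `n ≥ 2`
(`isConnected_compl_singleton_of_one_lt_rank`). [folklore] -/
theorem isPreconnected_ne_ne (hn : 2 ≤ n) (a b : sphere (0 : V) 1) :
    IsPreconnected {x : sphere (0 : V) 1 | x ≠ a ∧ x ≠ b} := by
  set φ := stereographic' n a with hφ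
  have hsrc : φ.source = {a}ᶜ := stereographic'_source a
  have htgt : φ.target = univ := stereographic'_target a
  have hcont : ContinuousOn φ.symm univ := htgt ▸ φ.continuousOn_symm
  by_cases hab : b = a
  · -- the complement of one point: image of `ℝⁿ`
    subst hab
    have hset : {x : sphere (0 : V) 1 | x ≠ b ∧ x ≠ b} = φ.symm '' univ := by
      ext x
      simp only [mem_setOf_eq, and_self, image_univ, mem_range]
      constructor
      · intro hx
        have hxs : x ∈ φ.source := by rw [hsrc]; exact hx
        exact ⟨φ x, φ.left_inv hxs⟩
      · rintro ⟨z, rfl⟩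
        have hz : φ.symm z ∈ φ.source := φ.map_target (by rw [htgt]; exact mem_univ z)
        rw [hsrc] at hz
        exact hz
    rw [hset]
    exact (isPreconnected_univ.image _ hcont)
  · have hbs : b ∈ φ.source := by rw [hsrc]; exact hab
    have hrank : 1 < Module.rank ℝ ES := by
      rw [← Module.finrank_eq_rank, finrank_euclideanSpace_fin]
      exact_mod_cast hn
    have hconn := (isConnected_compl_singleton_of_one_lt_rank hrank (φ b)).isPreconnected
    have hset : {x : sphere (0 : V) 1 | x ≠ a ∧ x ≠ b} = φ.symm '' {φ b}ᶜ := by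
      ext x
      simp only [mem_setOf_eq, mem_image, mem_compl_iff, mem_singleton_iff]
      constructor
      · rintro ⟨hxa, hxb⟩
        have hxs : x ∈ φ.source := by rw [hsrc]; exact hxa
        refine ⟨φ x, fun h ↦ hxb (φ.injOn hxs hbs h), φ.left_inv hxs⟩
      · rintro ⟨z, hz, rfl⟩
        have hzt : z ∈ φ.target := by rw [htgt]; exact mem_univ z
        have hzs : φ.symm z ∈ φ.source := φ.map_target hzt
        refine ⟨by rw [hsrc] at hzs; exact hzs, fun h ↦ hz ?_⟩
        rw [← h, φ.right_inv hzt]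
    rw [hset]
    exact hconn.image _ (hcont.mono (subset_univ _))

omit [(roundMetric (n := n) V).HasLeviCivita] in
/-- For `n ≥ 1` every point `p` of `Sⁿ` has an orthogonal point `q` (`⟪q, p⟫ = 0`), in
particular `q ≠ ±p` and `p ≠ -q`. [folklore] -/
theorem exists_inner_eq_zero (hn : 1 ≤ n) (p : sphere (0 : V) 1) :
    ∃ q : sphere (0 : V) 1, ⟪(q : V), (p : V)⟫ = 0 := by
  haveI : Nontrivial ES := by
    have : 0 < finrank ℝ ES := by rw [finrank_euclideanSpace_fin]; exact hn
    exact Module.nontrivial_of_finrank_pos this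
  obtain ⟨u, hu⟩ := exists_ne (0 : ES)
  set w : V := dι[p] u with hw
  have hw0 : w ≠ 0 := fun h ↦ by
    have h0 : dι[p] (0 : TangentSpace (𝓡 n) p) = 0 := map_zero _
    exact hu (mfderiv_coe_sphere_injective (n := n) p ((show dι[p] u = 0 from h).trans h0.symm))
  have hwp : ⟪(p : V), w⟫ = 0 := inner_coe_mvfderiv_coe_sphere p u
  refine ⟨⟨‖w‖⁻¹ • w, by
    rw [mem_sphere_zero_iff_norm, norm_smul, norm_inv, norm_norm, inv_mul_cancel₀ (norm_ne_zero_iff.2 hw0)]⟩, ?_⟩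
  show ⟪‖w‖⁻¹ • w, (p : V)⟫ = 0
  rw [real_inner_smul_left, real_inner_comm, hwp, mul_zero]

omit [Fact (finrank ℝ V = n + 1)] [(roundMetric (n := n) V).HasLeviCivita] in
/-- If `⟪q, p⟫ = 0` on the unit sphere then `q ≠ -p`, `p ≠ -q` and `q ≠ -q`. [folklore] -/
theorem ne_neg_of_inner_eq_zero [Fact (finrank ℝ V = n + 1)] {p q : sphere (0 : V) 1}
    (h : ⟪(q : V), (p : V)⟫ = 0) :
    (q : V) ≠ -(p : V) ∧ (p : V) ≠ -(q : V) ∧ (q : V) ≠ -(q : V) := by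
  have hpp : ⟪(p : V), (p : V)⟫ = 1 := by
    rw [real_inner_self_eq_norm_sq, norm_eq_of_mem_sphere, one_pow]
  have hqq : ⟪(q : V), (q : V)⟫ = 1 := by
    rw [real_inner_self_eq_norm_sq, norm_eq_of_mem_sphere, one_pow]
  refine ⟨fun h1 ↦ ?_, fun h2 ↦ ?_, fun h3 ↦ ?_⟩
  · rw [h1, inner_neg_left, hpp] at h; norm_num at h
  · rw [h2, inner_neg_right, hqq] at h; norm_num at h
  · have : (2 : ℝ) • (q : V) = 0 := by rw [two_smul]; nth_rewrite 2 [h3]; exact add_neg_cancel _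
    have hq0 : (q : V) = 0 := by
      rcases smul_eq_zero.1 this with h' | h'
      · norm_num at h'
      · exact h'
    rw [hq0, inner_zero_left] at hqq
    exact zero_ne_one hqq

/-! ### A linear isometry between the tangent spaces -/

omit [(roundMetric (n := n) V).HasLeviCivita] [I.Boundaryless] [CompleteSpace E] [T2Space M]
  [g.HasLeviCivita] in
/-- **A linear isometry `(T_p Sⁿ, g_round) → (T_{pt} M, g)` exists** when `dim M = n` and `g` is
positive definite (orthonormal bases on both sides; Mathlib's `OrthonormalBasis.equiv` for the
inner products `g.riemannianBundle`). [folklore] -/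
theorem exists_linearIsometry_tangent (hg : g.IsRiemannian) (hdim : finrank ℝ E = n)
    (p : sphere (0 : V) 1) (pt : M) :
    ∃ ι : ES →L[ℝ] E, ∀ u w : ES,
      g.val pt (show TangentSpace I pt from ι u) (show TangentSpace I pt from ι w) =
        (roundMetric (n := n) V).val p u w := by
  letI r1 := (roundMetric (n := n) V).riemannianBundle isRiemannian_roundMetric
  letI r2 := g.riemannianBundle hg
  haveI : FiniteDimensional ℝ (TangentSpace (𝓡 n) p) :=
    inferInstanceAs (FiniteDimensional ℝ (EuclideanSpace ℝ (Fin n)))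
  haveI : FiniteDimensional ℝ (TangentSpace I pt) := inferInstanceAs (FiniteDimensional ℝ E)
  have h1 : finrank ℝ (TangentSpace (𝓡 n) p) = n := finrank_euclideanSpace_fin
  have h2 : finrank ℝ (TangentSpace I pt) = n := hdim
  set b₁ := stdOrthonormalBasis ℝ (TangentSpace (𝓡 n) p) with hb₁
  set b₂ := (stdOrthonormalBasis ℝ (TangentSpace I pt)).reindex (finCongr (h2.trans h1.symm))
    with hb₂
  set L : TangentSpace (𝓡 n) p ≃ₗᵢ[ℝ] TangentSpace I pt := b₁.equiv b₂ (Equiv.refl _) with hL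
  set ιl : EuclideanSpace ℝ (Fin n) →ₗ[ℝ] E := L.toLinearEquiv.toLinearMap with hιl
  refine ⟨LinearMap.toContinuousLinearMap ιl, fun u w ↦ ?_⟩
  rw [← g.inner_eq hg, ← (roundMetric (n := n) V).inner_eq isRiemannian_roundMetric]
  exact L.inner_map_map u w

/-! ### Gluing two of Cartan's maps: a local isometry defined on all of `Sⁿ` -/

omit [(roundMetric (n := n) V).HasLeviCivita] [I.Boundaryless]
  [FiniteDimensional ℝ E] [CompleteSpace E] [T2Space M] [g.HasLeviCivita] in
/-- Transport of the isometry identity along a germ: if `F = f` near `x` then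
`g(dF X, dF Y)` and `g(df X, df Y)` agree at `x`. [folklore] -/
theorem val_mfderiv_congr_of_eventuallyEq {F f : sphere (0 : V) 1 → M}
    {x : sphere (0 : V) 1} (h : F =ᶠ[𝓝 x] f) (X Y : TangentSpace (𝓡 n) x) :
    g.val (F x) (mfderiv (𝓡 n) I F x X) (mfderiv (𝓡 n) I F x Y) =
      g.val (f x) (mfderiv (𝓡 n) I f x X) (mfderiv (𝓡 n) I f x Y) := by
  have e1 : F x = f x := h.eq_of_nhds
  have e2 : (mfderiv (𝓡 n) I F x : ES →L[ℝ] E) = mfderiv (𝓡 n) I f x := h.mfderiv_eq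
  have key : ∀ (y y' : M) (hy : y = y') (A A' : ES →L[ℝ] E) (hA : A = A'),
      g.val y (show TangentSpace I y from A X) (show TangentSpace I y from A Y) =
        g.val y' (show TangentSpace I y' from A' X) (show TangentSpace I y' from A' Y) := by
    intro y y' hy A A' hA; subst hy; subst hA; rfl
  exact key _ _ e1 _ _ e2

/-- **A complete Riemannian `n`-manifold of constant curvature `1` (`n ≥ 2`) receives a local
isometry from the round `Sⁿ`**: there is a `C^∞` map `F : Sⁿ → M` with
`g(dF X, dF Y) = g_round(X, Y)` everywhere (Lee 2018, proof of Thm. 12.4 (Killing–Hopf) through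
Cor. 12.3 / Thm. 10.14; do Carmo, *Riemannian Geometry*, Ch. 8, Thm. 4.1, proof: `f = exp_{p̃} ∘ i ∘ exp_p⁻¹`
is a local isometry on `Sⁿ ∖ {-p}` by Cartan's theorem, a second such map at `q` agrees with `f`
on the connected overlap by rigidity, and the two glue). Hypotheses: `g` positive definite `C^∞`
with geodesically complete Levi-Civita connection and constant sectional curvature `1`,
`dim M = n`, `pt ∈ M` the prescribed image of `p`. [cite: Lee2018, Thm. 12.4 (proof)] -/
theorem exists_isLocalIsometry (hn : 2 ≤ n) (hg : g.IsRiemannian)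
    (hK : g.HasConstantSectionalCurvatureWith g.leviCivita 1)
    (hc : IsGeodesicallyComplete g.leviCivita) (hdim : finrank ℝ E = n)
    (p : sphere (0 : V) 1) (pt : M) :
    ∃ F : sphere (0 : V) 1 → M, F p = pt ∧ ContMDiff (𝓡 n) I ∞ F ∧
      ∀ (x : sphere (0 : V) 1) (X Y : TangentSpace (𝓡 n) x),
        g.val (F x) (mfderiv (𝓡 n) I F x X) (mfderiv (𝓡 n) I F x Y) =
          (roundMetric (n := n) V).val x X Y := by
  classical
  -- regularity package of `g`
  have h2 : (2 : ℕ∞ω) ≤ ∞ := WithTop.coe_le_coe.2 le_top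
  have hk1 : ((1 : ℕ∞) : ℕ∞ω) + 1 ≤ ∞ := by
    rw [show ((1 : ℕ∞) : ℕ∞ω) + 1 = 2 by norm_num]; exact h2
  haveI : CovariantDerivative.ContMDiffCovariantDerivative g.leviCivita 1 :=
    ⟨g.isLocallyContMDiff_leviCivita_holds 1 hk1 univ isOpen_univ⟩
  haveI : CovariantDerivative.ContMDiffCovariantDerivative g.leviCivita ∞ :=
    ⟨g.isLocallyContMDiff_leviCivita_holds ⊤ (le_of_eq rfl) univ isOpen_univ⟩
  have hcov₁ : g.leviCivita.IsLocallyContMDiff 1 := g.isLocallyContMDiff_leviCivita_holds 1 hk1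
  -- the first map, at `p`
  obtain ⟨ι₀, hι₀⟩ := exists_linearIsometry_tangent (V := V) hg hdim p pt
  set f₁ : sphere (0 : V) 1 → M := puncturedMap p g pt ι₀ with hf₁
  have P1s : ∀ x : sphere (0 : V) 1, (x : V) ≠ -(p : V) → ContMDiffAt (𝓡 n) I ∞ f₁ x :=
    fun x hx ↦ contMDiffAt_puncturedMap hc p pt ι₀ hx
  have P1i : ∀ x : sphere (0 : V) 1, (x : V) ≠ -(p : V) → ∀ X Y : TangentSpace (𝓡 n) x,
      g.val (f₁ x) (mfderiv (𝓡 n) I f₁ x X) (mfderiv (𝓡 n) I f₁ x Y) =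
        (roundMetric (n := n) V).val x X Y :=
    fun x hx X Y ↦ val_mfderiv_puncturedMap hg hK hcov₁ hc p pt ι₀ hι₀ hx X Y
  -- the second base point `q ⊥ p`
  obtain ⟨q, hqp⟩ := exists_inner_eq_zero (V := V) (n := n) (by omega) p
  have hpq' : (p : V) ≠ (q : V) := fun h ↦ by
    rw [← h, real_inner_self_eq_norm_sq, norm_eq_of_mem_sphere] at hqp; norm_num at hqp
  obtain ⟨hq1, hq2, hq3⟩ := ne_neg_of_inner_eq_zero (n := n) hqp
  -- the second map, at `q`, with differential `df₁(q)`
  set ι₁ : ES →L[ℝ] E := (mfderiv (𝓡 n) I f₁ q : ES →L[ℝ] E) with hι₁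
  have hι₁' : ∀ u w : ES, g.val (f₁ q) (show TangentSpace I (f₁ q) from ι₁ u)
      (show TangentSpace I (f₁ q) from ι₁ w) = (roundMetric (n := n) V).val q u w :=
    fun u w ↦ P1i q hq1 u w
  set f₂ : sphere (0 : V) 1 → M := puncturedMap q g (f₁ q) ι₁ with hf₂
  have P2s : ∀ x : sphere (0 : V) 1, (x : V) ≠ -(q : V) → ContMDiffAt (𝓡 n) I ∞ f₂ x :=
    fun x hx ↦ contMDiffAt_puncturedMap hc q (f₁ q) ι₁ hx
  have P2i : ∀ x : sphere (0 : V) 1, (x : V) ≠ -(q : V) → ∀ X Y : TangentSpace (𝓡 n) x,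
      g.val (f₂ x) (mfderiv (𝓡 n) I f₂ x X) (mfderiv (𝓡 n) I f₂ x Y) =
        (roundMetric (n := n) V).val x X Y :=
    fun x hx X Y ↦ val_mfderiv_puncturedMap hg hK hcov₁ hc q (f₁ q) ι₁ hι₁' hx X Y
  -- agreement on the overlap `U = Sⁿ ∖ {-p, -q}` by rigidity
  set U : Set (sphere (0 : V) 1) := {x | (x : V) ≠ -(p : V) ∧ (x : V) ≠ -(q : V)} with hU
  have hUeq : U = {x : sphere (0 : V) 1 | x ≠ -p ∧ x ≠ -q} := by
    ext x
    simp only [hU, mem_setOf_eq, ne_eq, ← coe_neg_sphere, Subtype.coe_injective.eq_iff]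
  have hUo : IsOpen U :=
    (isOpen_ne_fun continuous_subtype_val continuous_const).inter
      (isOpen_ne_fun continuous_subtype_val continuous_const)
  have hUc : IsPreconnected U := by rw [hUeq]; exact isPreconnected_ne_ne hn (-p) (-q)
  have hEq : EqOn f₁ f₂ U := by
    refine IsometryRigidity.eqOn_of_isometry_of_oneJet_eq (g := g) (gN := roundMetric (n := n) V)
      (by rw [hdim, finrank_euclideanSpace_fin]) hUo hUc
      (fun x hx ↦ (P1s x hx.1).contMDiffWithinAt) (fun x hx ↦ (P2s x hx.2).contMDiffWithinAt)
      (fun x hx X Y ↦ P1i x hx.1 X Y) (fun x hx X Y ↦ P2i x hx.2 X Y) (y₀ := q) ⟨hq1, hq3⟩ ?_ ?_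
    · exact (puncturedMap_self q (f₁ q) ι₁).symm
    · ext X
      exact (mfderiv_puncturedMap_self hc q (f₁ q) ι₁ hq3 X).symm
  -- the glued map
  set F : sphere (0 : V) 1 → M := fun x ↦ if (x : V) = -(p : V) then f₂ x else f₁ x with hF
  have hF₁ : ∀ x : sphere (0 : V) 1, (x : V) ≠ -(p : V) → F =ᶠ[𝓝 x] f₁ := by
    intro x hx
    filter_upwards [(isOpen_ne_fun continuous_subtype_val continuous_const).mem_nhds hx]
      with y hy
    exact if_neg hy
  have hF₂ : ∀ x : sphere (0 : V) 1, (x : V) ≠ -(q : V) → F =ᶠ[𝓝 x] f₂ := by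
    intro x hx
    filter_upwards [(isOpen_ne_fun continuous_subtype_val continuous_const).mem_nhds hx]
      with y hy
    by_cases hyp : (y : V) = -(p : V)
    · exact if_pos hyp
    · rw [hF]; simp only [hyp, if_false]; exact hEq ⟨hyp, hy⟩
  have hpq : ∀ x : sphere (0 : V) 1, (x : V) ≠ -(p : V) ∨ (x : V) ≠ -(q : V) := by
    intro x
    by_contra h
    simp only [not_or, not_ne_iff] at h
    exact hpq' (neg_injective (h.1.symm.trans h.2))
  refine ⟨F, ?_, fun x ↦ ?_, fun x X Y ↦ ?_⟩
  · -- `F p = f₁ p = pt`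
    have hp' : ((p : sphere (0 : V) 1) : V) ≠ -(p : V) := (ne_neg_of_inner_eq_zero (n := n)
      (show ⟪(p : V), (q : V)⟫ = 0 by rw [real_inner_comm]; exact hqp)).2.2
    rw [(hF₁ p hp').eq_of_nhds]
    exact puncturedMap_self p pt ι₀
  · rcases hpq x with hx | hx
    · exact (P1s x hx).congr_of_eventuallyEq (hF₁ x hx)
    · exact (P2s x hx).congr_of_eventuallyEq (hF₂ x hx)
  · rcases hpq x with hx | hx
    · rw [val_mfderiv_congr_of_eventuallyEq (hF₁ x hx)]; exact P1i x hx X Y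
    · rw [val_mfderiv_congr_of_eventuallyEq (hF₂ x hx)]; exact P2i x hx X Y

end SphereLocalIsometry

end Literature.Geometry.Riemannian
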